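import Literature.MathematicalPhysics.QuantumLattice.HubbardNNNHoppingCut
import Literature.MathematicalPhysics.QuantumLattice.HubbardNNNHoppingThermodynamicLimit
import HarnessLib

/-!
# Open-cluster product states: penalty-free upper bounds for the `t–t'` torus and for the
# thermodynamic-limit energy density

Ladder R1–R4 infrastructure with certified numbers in view; no claim on `H`/`H₀` (the summit) is made
or implied here.

## Content

The standard *cluster variational principle* for the repulsive `t–t'–U` Hubbard model
`hubbardRectTorusTT' L₁ L₂ t t' U` (LeBlanc et al. (2015) eq. (1); `HubbardNNNHopping.lean`): cut the
torus into disjoint open clusters, put an arbitrary state of fixed particle number on each cluster and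
take the graded (fermionic) product. Because the clusters are filled with states of DEFINITE particle
number, every hopping term joining two different clusters — nearest-neighbour across a block face,
next-nearest-neighbour across a face or a corner, or wrapping around the torus — has ZERO
expectation, while the on-site repulsion is a sum of intra-cluster terms. Hence, with no boundary
penalty at all,

`E_torus(K_x a × K_y b; Σ_{ij} N_{ij}) ≤ Σ_{ij} E_open(a × b; N_{ij})`     (`K_x, K_y ≥ 2`)

(`groundEnergy_hubbardRectTorusTT'_le_sum_openBox`), where `E_open(a × b; N)` are the sector
ground-state energies of the OPEN cluster Hamiltonian `hubbardOpenBoxTT' a b t t' U` (nearest-neighbour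
bonds of the open `a × b` grid with amplitude `t`, its diagonal bonds with amplitude `t'`, on-site
`U`; no periodic bonds). Dividing by the volume along the tori `L = 2K · P_x a · P_y b` filled by a
`P_x × P_y`-periodic pattern of cluster fillings and passing to the limit in the definition of the
energy density `energyDensityTT'` (`HubbardNNNHoppingThermodynamicLimit.lean`) gives the
thermodynamic-limit statement

`e(t, t', U, n̄) ≤ (Σ_{ij} E_open(a × b; N_{ij})) / (P_x a · P_y b)`,  `n̄ = Σ N_{ij} / (P_x a P_y b) < 2`, `U ≥ 0`

(`energyDensityTT'_le_openBox_pattern`; uniform pattern `energyDensityTT'_le_openBox`; variational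
form with an explicit unit trial vector of the cluster `energyDensityTT'_le_re_expect_openBox`). This is
the form in which an exactly evaluated cluster state (e.g. an exact-rational Rayleigh quotient of an
open-cluster vector) certifies an UPPER bound on the infinite-volume energy density at `t' ≠ 0`, where
no momentum-space (Slater-determinant) bound is presently formalised; patterns mixing fillings `N` and
`N + 1` reach every rational density with denominator `P_x a P_y b`.

Sources. The sub-box argument is Ruelle, *Statistical Mechanics: Rigorous Results* (1969) §3.3:
Proposition 3.3.2(b), eq. (3.5), and 3.3.3, eq. (3.11) (sub-additivity of the fixed-particle-number box
energies `E(⋃ Λ_i, Σ n_i, ·) ≤ Σ E(Λ_i, n_i, ·) + tail` over the sub-cubes of a special sequence of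
cubes; the quantum-lattice boundary estimate is §2.3, Proposition 2.3.1, eq. (3.2)), here in its
simplest zero-temperature form, where fixed particle number per cluster makes the tail vanish
identically; the CAR product-state bookkeeping is Bratteli–Robinson II
(1997) §5.2.2, already formalised as `groundEnergy_twoGraph_le_add_of_cut` (`HubbardNNNHoppingCut.lean`,
whose four "discrepancy" penalties all vanish for INDUCED sub-bond-sets — the only new observation
needed, `groundEnergy_twoGraph_le_add_of_induced`). The model is LeBlanc et al., PRX 5, 041041 (2015)
eq. (1).

## Design

* Generic part (namespace `ThermodynamicLimit`, any two bond sets `G, G'` on `Fin A ×ₗ Fin B`):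
  strips `stripEmb` (iterate the cut `rectCastAdd`/`rectNatAdd` of `HubbardRectangularTorus.lean`,
  `groundEnergy_twoGraph_le_sum_strips`), then blocks `blockEmb` by transposing with `rectSwap`
  (`groundEnergy_twoGraph_le_sum_blocks`). The bound is stated for the INDUCED bond sets
  `G.comap (blockEmb …)`, so it applies verbatim to any finite-range two-graph Hamiltonian.
* Model part: the open-cluster graphs `rectBoxGraph a b` (grid) and `rectBoxDiagGraph a b` (diagonals),
  `hubbardOpenBoxTT'`, and the identification of the induced bond sets of a block of the torus
  `ℤ/K_x a × ℤ/K_y b`, `K_x, K_y ≥ 2`, with them (`comap_blockEmb_fermionRectTorusGraph`,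
  `comap_blockEmb_fermionRectTorusDiagGraph`; the hypothesis `K ≥ 2` excludes a periodic bond from a
  block to itself).
* Limit part: exact particle numbers along the subsequence `L = 2K P_x a P_y b` (`rectN_eq_of_mul_sq_eq`),
  periodic repetition of the pattern (`sum_comp_modNat`), and `energyDensityTT'_le_of_frequently_le`.

Not here: any evaluation of `E_open` (that is the business of certificates), lower bounds, `U < 0`,
and densities `n̄ = 2`.
-/

noncomputable section

open Matrix Finset Filter Topology
open scoped ComplexOrder BigOperators

namespace Literature.MathematicalPhysics.QuantumLattice

namespace ThermodynamicLimit

/-! ### Zero-discrepancy cuts: induced sub-Hamiltonians -/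

section InducedCut

variable {Λ₁ Λ₂ Λ : Type*} [LinearOrder Λ₁] [Fintype Λ₁] [LinearOrder Λ₂] [Fintype Λ₂]
  [LinearOrder Λ] [Fintype Λ]

/-- Two decidability structures on the same adjacency give the same Hubbard Hamiltonian (the
instance only decides the `if G.Adj x y`). [folklore] -/
private theorem hamiltonian_congr {G₁ G₂ : SimpleGraph Λ} [DecidableRel G₁.Adj] [DecidableRel G₂.Adj]
    (h : G₁ = G₂) (t U : ℝ) : hamiltonian G₁ t U = hamiltonian G₂ t U := by
  subst h
  congr!

omit [LinearOrder Λ] [Fintype Λ] in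
/-- An induced bond set has no discrepancy with the ambient one. [folklore] -/
private theorem card_discrepancy_comap_le_zero {Λ₀ : Type*} [LinearOrder Λ₀] [Fintype Λ₀]
    (H : SimpleGraph Λ) [DecidableRel H.Adj] (e : Λ₀ → Λ) :
    #{p : Λ₀ × Λ₀ | ¬ (H.Adj (e p.1) (e p.2) ↔ (H.comap e).Adj p.1 p.2)} ≤ 0 := by
  rw [Nat.le_zero, Finset.card_eq_zero, Finset.filter_eq_empty_iff]
  intro p _
  simp [SimpleGraph.comap_adj]

/-- **Penalty-free cut onto induced sub-Hamiltonians.** If the sites of the two-graph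
Hamiltonian `hamiltonian G t U + hamiltonian G' t' U'` are the ordered disjoint union of two blocks
(along the strictly monotone `e₁ < e₂`), then for the INDUCED bond sets `G.comap e_i`, `G'.comap e_i`
(every bond of the big system inside block `i`, and no other):
`E(N₁ + N₂) ≤ E₁(N₁) + E₂(N₂)` with NO boundary term — the bonds joining the two blocks have zero
expectation in the graded product of an `N₁`-particle vector with any vector
(`groundEnergy_twoGraph_le_add_of_cut` with all four discrepancy counts `0`). Ruelle (1969) §3.3,
Proposition 3.3.2, eq. (3.4) with zero tail. [cite: Ruelle1969, §3.3] -/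
theorem groundEnergy_twoGraph_le_add_of_induced (G G' : SimpleGraph Λ) [DecidableRel G.Adj]
    [DecidableRel G'.Adj] {e₁ : Λ₁ → Λ} {e₂ : Λ₂ → Λ} (he₁ : StrictMono e₁) (he₂ : StrictMono e₂)
    (h12 : ∀ x y, e₁ x < e₂ y) (hcov : ∀ z, (∃ x, e₁ x = z) ∨ ∃ y, e₂ y = z) (t U t' U' : ℝ)
    {N₁ N₂ : ℕ} (hN₁ : N₁ ≤ 2 * Fintype.card Λ₁) (hN₂ : N₂ ≤ 2 * Fintype.card Λ₂) :
    groundEnergy (hamiltonian G t U + hamiltonian G' t' U') (N₁ + N₂) ≤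
      groundEnergy (hamiltonian (G.comap e₁) t U + hamiltonian (G'.comap e₁) t' U') N₁ +
        groundEnergy (hamiltonian (G.comap e₂) t U + hamiltonian (G'.comap e₂) t' U') N₂ := by
  have h := groundEnergy_twoGraph_le_add_of_cut (G.comap e₁) (G'.comap e₁) (G.comap e₂)
    (G'.comap e₂) G G' he₁ he₂ h12 hcov (card_discrepancy_comap_le_zero G e₁)
    (card_discrepancy_comap_le_zero G e₂) (card_discrepancy_comap_le_zero G' e₁)
    (card_discrepancy_comap_le_zero G' e₂) t U t' U' hN₁ hN₂
  simpa using h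

end InducedCut

/-! ### Strips of a cylinder `Fin A ×ₗ Fin b`, `A = K M` -/

section Strips

variable {b : ℕ}

/-- The index bound of the strip embedding: `i M + x < A` for `i < K`, `x < M`, `A = K M`.
[folklore] -/
private theorem stripIndex_lt {M K A : ℕ} (hA : A = K * M) (i : Fin K) (x : Fin M) :
    (i : ℕ) * M + x < A := by
  have hi : (i : ℕ) + 1 ≤ K := i.isLt
  have h1 : ((i : ℕ) + 1) * M ≤ K * M := Nat.mul_le_mul_right M hi
  have h2 : ((i : ℕ) + 1) * M = (i : ℕ) * M + M := by ring
  have hx := x.isLt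
  omega

/-- The `i`-th strip `x ↦ i M + x` of `Fin A ×ₗ Fin b`, `A = K M` (second coordinate fixed).
[folklore] -/
def stripEmb {M K A : ℕ} (hA : A = K * M) (i : Fin K) (p : Fin M ×ₗ Fin b) : Fin A ×ₗ Fin b :=
  toLex (⟨(i : ℕ) * M + (ofLex p).1, stripIndex_lt hA i (ofLex p).1⟩, (ofLex p).2)

/-- The `x`-coordinate of a strip site. [folklore] -/
@[simp] private theorem ofLex_stripEmb_fst {M K A : ℕ} (hA : A = K * M) (i : Fin K) (p : Fin M ×ₗ Fin b) :
    ((ofLex (stripEmb hA i p)).1 : ℕ) = (i : ℕ) * M + (ofLex p).1 := rfl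

/-- The `y`-coordinate of a strip site. [folklore] -/
@[simp] private theorem ofLex_stripEmb_snd {M K A : ℕ} (hA : A = K * M) (i : Fin K) (p : Fin M ×ₗ Fin b) :
    (ofLex (stripEmb hA i p)).2 = (ofLex p).2 := rfl

/-- The lower block of the cut at `K M` followed by the `i`-th strip of `Fin (K M) ×ₗ Fin b` is the
`i`-th strip of `Fin (K M + M) ×ₗ Fin b`. [folklore] -/
private theorem rectCastAdd_comp_stripEmb {M K : ℕ} (h₁ : K * M = K * M) (h₂ : K * M + M = (K + 1) * M)
    (i : Fin K) :
    rectCastAdd (K * M) M b ∘ stripEmb h₁ i = stripEmb (b := b) h₂ (Fin.castSucc i) := by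
  funext p
  refine ofLex.injective (Prod.ext (Fin.ext ?_) ?_)
  · simp [rectCastAdd, stripEmb]
  · simp [rectCastAdd, stripEmb]

/-- The upper block of the cut at `K M` is the last strip of `Fin (K M + M) ×ₗ Fin b`. [folklore] -/
private theorem rectNatAdd_eq_stripEmb {M K : ℕ} (h₂ : K * M + M = (K + 1) * M) :
    rectNatAdd (K * M) M b = stripEmb (b := b) h₂ (Fin.last K) := by
  funext p
  refine ofLex.injective (Prod.ext (Fin.ext ?_) ?_)
  · simp [rectNatAdd, stripEmb]
  · simp [rectNatAdd, stripEmb]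

variable {Λ : Type*} [LinearOrder Λ] [Fintype Λ] in
/-- The empty sector costs nothing: `E(0) ≤ 0` for every two-graph Hamiltonian (the vacuum is a
unit `0`-particle vector annihilated by both Hubbard Hamiltonians). [folklore] -/
private theorem groundEnergy_twoGraph_zero_le (G G' : SimpleGraph Λ) [DecidableRel G.Adj]
    [DecidableRel G'.Adj] (t U t' U' : ℝ) :
    groundEnergy (hamiltonian G t U + hamiltonian G' t' U') 0 ≤ 0 := by
  have hN : IsNParticle 0 (vacuum : Fock (Orb Λ)) := by
    intro s hs
    rw [vacuum, Pi.single_apply, if_neg]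
    exact fun h => hs (by rw [h, Finset.card_empty])
  have h1 : star (vacuum : Fock (Orb Λ)) ⬝ᵥ vacuum = 1 := by
    rw [vacuum, dotProduct_single, Pi.star_apply, Pi.single_eq_same, star_one, one_mul]
  have h := groundEnergy_le_re_expect (hamiltonian G t U + hamiltonian G' t' U') hN h1
  rwa [expect, add_mulVec, hamiltonian_mulVec_vacuum, hamiltonian_mulVec_vacuum, add_zero,
    dotProduct_zero, Complex.zero_re] at h

/-- **Strips, penalty-free.** For ANY two bond sets `G, G'` on the cylinder of sites
`Fin A ×ₗ Fin b`, `A = K M`, and block particle numbers `N_i ≤ 2 M b`: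
`E_{G,G'}(Σ_i N_i) ≤ Σ_i E_{G|strip i, G'|strip i}(N_i)`, the right-hand side built from the
INDUCED bond sets of the `K` strips `[i M, (i+1) M) × Fin b` (iterate
`groundEnergy_twoGraph_le_add_of_induced`, splitting off the last strip). Ruelle (1969) §3.3,
Proposition 3.3.2(b), eq. (3.5) with zero tail. [cite: Ruelle1969, §3.3] -/
theorem groundEnergy_twoGraph_le_sum_strips (M : ℕ) (t U t' U' : ℝ) :
    ∀ (K A : ℕ) (hA : A = K * M) (G G' : SimpleGraph (Fin A ×ₗ Fin b)) [DecidableRel G.Adj]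
      [DecidableRel G'.Adj] (Ns : Fin K → ℕ), (∀ i, Ns i ≤ 2 * (M * b)) →
      groundEnergy (hamiltonian G t U + hamiltonian G' t' U') (∑ i, Ns i) ≤
        ∑ i, groundEnergy (hamiltonian (G.comap (stripEmb hA i)) t U +
          hamiltonian (G'.comap (stripEmb hA i)) t' U') (Ns i) := by
  intro K
  induction K with
  | zero =>
      intro A hA G G' _ _ Ns _
      simp only [Finset.univ_eq_empty, Finset.sum_empty]
      exact groundEnergy_twoGraph_zero_le G G' t U t' U'
  | succ K ih =>
      intro A hA G G' _ _ Ns hNs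
      have hA' : A = K * M + M := by rw [hA]; ring
      subst hA'
      have eN : ∑ i, Ns i = ∑ i : Fin K, Ns (Fin.castSucc i) + Ns (Fin.last _) :=
        Fin.sum_univ_castSucc _
      have eE : ∑ i, groundEnergy (hamiltonian (G.comap (stripEmb hA i)) t U +
            hamiltonian (G'.comap (stripEmb hA i)) t' U') (Ns i) =
          ∑ i : Fin K, groundEnergy (hamiltonian (G.comap (stripEmb hA (Fin.castSucc i))) t U +
              hamiltonian (G'.comap (stripEmb hA (Fin.castSucc i))) t' U') (Ns (Fin.castSucc i)) +
            groundEnergy (hamiltonian (G.comap (stripEmb hA (Fin.last _))) t U +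
              hamiltonian (G'.comap (stripEmb hA (Fin.last _))) t' U') (Ns (Fin.last _)) :=
        Fin.sum_univ_castSucc _
      rw [eN, eE]
      have h1 : ∑ i : Fin K, Ns (Fin.castSucc i) ≤ 2 * Fintype.card (Fin (K * M) ×ₗ Fin b) := by
        calc ∑ i : Fin K, Ns (Fin.castSucc i) ≤ ∑ _i : Fin K, 2 * (M * b) :=
              Finset.sum_le_sum fun i _ => hNs _
          _ = 2 * Fintype.card (Fin (K * M) ×ₗ Fin b) := by
              rw [Finset.sum_const, Finset.card_univ, Fintype.card_fin, smul_eq_mul, card_rectSites]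
              ring
      have h2 : Ns (Fin.last K) ≤ 2 * Fintype.card (Fin M ×ₗ Fin b) := by
        rw [card_rectSites]; exact hNs _
      have hcut := groundEnergy_twoGraph_le_add_of_induced G G'
        (strictMono_rectCastAdd (K * M) M b) (strictMono_rectNatAdd (K * M) M b)
        (rectCastAdd_lt_rectNatAdd (K * M) M b) (rectCastAdd_cover (K * M) M b)
        t U t' U' h1 h2
      have hih := ih (K * M) rfl (G.comap (rectCastAdd (K * M) M b))
        (G'.comap (rectCastAdd (K * M) M b)) (fun i => Ns (Fin.castSucc i)) (fun i => hNs _)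
      -- identify the strips
      have hG : ∀ i : Fin K, (G.comap (rectCastAdd (K * M) M b)).comap (stripEmb rfl i) =
          G.comap (stripEmb hA (Fin.castSucc i)) := by
        intro i
        rw [SimpleGraph.comap_comap, rectCastAdd_comp_stripEmb rfl hA]
      have hG' : ∀ i : Fin K, (G'.comap (rectCastAdd (K * M) M b)).comap (stripEmb rfl i) =
          G'.comap (stripEmb hA (Fin.castSucc i)) := by
        intro i
        rw [SimpleGraph.comap_comap, rectCastAdd_comp_stripEmb rfl hA]
      have hL : G.comap (rectNatAdd (K * M) M b) = G.comap (stripEmb hA (Fin.last K)) := by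
        rw [rectNatAdd_eq_stripEmb hA]
      have hL' : G'.comap (rectNatAdd (K * M) M b) = G'.comap (stripEmb hA (Fin.last K)) := by
        rw [rectNatAdd_eq_stripEmb hA]
      have hih' : groundEnergy (hamiltonian (G.comap (rectCastAdd (K * M) M b)) t U +
            hamiltonian (G'.comap (rectCastAdd (K * M) M b)) t' U')
            (∑ i : Fin K, Ns (Fin.castSucc i)) ≤
          ∑ i : Fin K, groundEnergy (hamiltonian (G.comap (stripEmb hA (Fin.castSucc i))) t U +
              hamiltonian (G'.comap (stripEmb hA (Fin.castSucc i))) t' U') (Ns (Fin.castSucc i)) := by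
        refine hih.trans (le_of_eq (Finset.sum_congr rfl fun i _ => ?_))
        rw [hamiltonian_congr (hG i), hamiltonian_congr (hG' i)]
      rw [hamiltonian_congr hL, hamiltonian_congr hL'] at hcut
      linarith

end Strips

/-! ### Blocks of `Fin A ×ₗ Fin B`, `A = K_x a`, `B = K_y b`: strips, transpose, strips -/

section Blocks

/-- **Transposition invariance for arbitrary bond sets.** Pulling two bond sets on
`Fin A ×ₗ Fin B` back along the coordinate swap `Fin B ×ₗ Fin A ≃ Fin A ×ₗ Fin B` does not change
the sector ground-state energies (the swap is a site bijection carrying the pulled-back adjacency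
onto the original one; `groundEnergy_relabel`, Bratteli–Robinson II §5.2.2).
[cite: BratteliRobinsonII1997, §5.2.2] -/
theorem groundEnergy_twoGraph_comap_rectSwap {A B : ℕ} (H H' : SimpleGraph (Fin A ×ₗ Fin B))
    [DecidableRel H.Adj] [DecidableRel H'.Adj] (t U t' U' : ℝ) (N : ℕ) :
    groundEnergy (hamiltonian (H.comap (rectSwap B A)) t U +
        hamiltonian (H'.comap (rectSwap B A)) t' U') N =
      groundEnergy (hamiltonian H t U + hamiltonian H' t' U') N := by
  have hH : ∀ x y, (H.comap (rectSwap B A)).Adj (rectSwap A B x) (rectSwap A B y) ↔ H.Adj x y :=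
    fun _ _ => Iff.rfl
  have hH' : ∀ x y, (H'.comap (rectSwap B A)).Adj (rectSwap A B x) (rectSwap A B y) ↔ H'.Adj x y :=
    fun _ _ => Iff.rfl
  rw [← groundEnergy_relabel (Orb.mapEquiv (rectSwap A B)) (hamiltonian H t U + hamiltonian H' t' U') N,
    map_add, relabel_hamiltonian H (H.comap (rectSwap B A)) (rectSwap A B) hH t U,
    relabel_hamiltonian H' (H'.comap (rectSwap B A)) (rectSwap A B) hH' t' U']

/-- The `(i, j)`-th block `(x, y) ↦ (i a + x, j b + y)` of `Fin A ×ₗ Fin B`, `A = K_x a`,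
`B = K_y b`. [folklore] -/
def blockEmb {a b Kx Ky A B : ℕ} (hA : A = Kx * a) (hB : B = Ky * b) (i : Fin Kx) (j : Fin Ky)
    (p : Fin a ×ₗ Fin b) : Fin A ×ₗ Fin B :=
  toLex (⟨(i : ℕ) * a + (ofLex p).1, stripIndex_lt hA i (ofLex p).1⟩,
    ⟨(j : ℕ) * b + (ofLex p).2, stripIndex_lt hB j (ofLex p).2⟩)

/-- The `x`-coordinate of a block site. [folklore] -/
@[simp] private theorem ofLex_blockEmb_fst {a b Kx Ky A B : ℕ} (hA : A = Kx * a) (hB : B = Ky * b)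
    (i : Fin Kx) (j : Fin Ky) (p : Fin a ×ₗ Fin b) :
    ((ofLex (blockEmb hA hB i j p)).1 : ℕ) = (i : ℕ) * a + (ofLex p).1 := rfl

/-- The `y`-coordinate of a block site. [folklore] -/
@[simp] private theorem ofLex_blockEmb_snd {a b Kx Ky A B : ℕ} (hA : A = Kx * a) (hB : B = Ky * b)
    (i : Fin Kx) (j : Fin Ky) (p : Fin a ×ₗ Fin b) :
    ((ofLex (blockEmb hA hB i j p)).2 : ℕ) = (j : ℕ) * b + (ofLex p).2 := rfl

/-- Strip `i` in the first coordinate, swap, strip `j`, swap back = block `(i, j)`. [folklore] -/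
private theorem stripEmb_swap_stripEmb_swap {a b Kx Ky A B : ℕ} (hA : A = Kx * a) (hB : B = Ky * b)
    (i : Fin Kx) (j : Fin Ky) :
    stripEmb (b := B) hA i ∘ rectSwap B a ∘ stripEmb (b := a) hB j ∘ rectSwap a b =
      blockEmb hA hB i j := by
  funext p
  rfl

/-- **Blocks, penalty-free.** For ANY two bond sets `G, G'` on `Fin A ×ₗ Fin B` with
`A = K_x a`, `B = K_y b`, and block particle numbers `N_{ij} ≤ 2ab`:
`E_{G,G'}(Σ_{ij} N_{ij}) ≤ Σ_{ij} E_{G|block ij, G'|block ij}(N_{ij})` (induced bond sets of the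
blocks `[i a, (i+1) a) × [j b, (j+1) b)`): strips in the first coordinate, the coordinate swap,
strips again, swap back. Ruelle (1969) §3.3, eq. (3.11) with zero tail. [cite: Ruelle1969, §3.3] -/
theorem groundEnergy_twoGraph_le_sum_blocks (a b : ℕ) (t U t' U' : ℝ) (Kx Ky A B : ℕ)
    (hA : A = Kx * a) (hB : B = Ky * b) (G G' : SimpleGraph (Fin A ×ₗ Fin B))
    [DecidableRel G.Adj] [DecidableRel G'.Adj] (Ns : Fin Kx → Fin Ky → ℕ)
    (hNs : ∀ i j, Ns i j ≤ 2 * (a * b)) :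
    groundEnergy (hamiltonian G t U + hamiltonian G' t' U') (∑ i, ∑ j, Ns i j) ≤
      ∑ i, ∑ j, groundEnergy (hamiltonian (G.comap (blockEmb hA hB i j)) t U +
        hamiltonian (G'.comap (blockEmb hA hB i j)) t' U') (Ns i j) := by
  -- strips in the first coordinate
  have hS : ∀ i, ∑ j, Ns i j ≤ 2 * (a * B) := by
    intro i
    calc ∑ j, Ns i j ≤ ∑ _j : Fin Ky, 2 * (a * b) := Finset.sum_le_sum fun j _ => hNs i j
      _ = 2 * (a * B) := by
          rw [Finset.sum_const, Finset.card_univ, Fintype.card_fin, smul_eq_mul, hB]; ring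
  have h1 := groundEnergy_twoGraph_le_sum_strips (b := B) a t U t' U' Kx A hA G G'
    (fun i => ∑ j, Ns i j) hS
  refine h1.trans (Finset.sum_le_sum fun i _ => ?_)
  -- strip `i`: swap, strips in the (new) first coordinate, swap back
  rw [← groundEnergy_twoGraph_comap_rectSwap (G.comap (stripEmb hA i)) (G'.comap (stripEmb hA i))]
  have hS' : ∀ j, Ns i j ≤ 2 * (b * a) := fun j => by rw [mul_comm b a]; exact hNs i j
  have h2 := groundEnergy_twoGraph_le_sum_strips (b := a) b t U t' U' Ky B hB
    ((G.comap (stripEmb hA i)).comap (rectSwap B a)) ((G'.comap (stripEmb hA i)).comap (rectSwap B a))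
    (fun j => Ns i j) hS'
  refine h2.trans (le_of_eq (Finset.sum_congr rfl fun j _ => ?_))
  rw [← groundEnergy_twoGraph_comap_rectSwap
    ((((G.comap (stripEmb hA i)).comap (rectSwap B a))).comap (stripEmb hB j))
    ((((G'.comap (stripEmb hA i)).comap (rectSwap B a))).comap (stripEmb hB j))]
  have hG : (((G.comap (stripEmb hA i)).comap (rectSwap B a)).comap (stripEmb hB j)).comap
      (rectSwap a b) = G.comap (blockEmb hA hB i j) := by
    simp only [SimpleGraph.comap_comap]
    rw [← stripEmb_swap_stripEmb_swap hA hB i j]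
    rfl
  have hG' : (((G'.comap (stripEmb hA i)).comap (rectSwap B a)).comap (stripEmb hB j)).comap
      (rectSwap a b) = G'.comap (blockEmb hA hB i j) := by
    simp only [SimpleGraph.comap_comap]
    rw [← stripEmb_swap_stripEmb_swap hA hB i j]
    rfl
  rw [hamiltonian_congr hG, hamiltonian_congr hG']

end Blocks

end ThermodynamicLimit

/-! ### Open rectangular clusters (free boundary conditions) -/

section OpenBox

open ThermodynamicLimit

/-- Nearest neighbours along one lattice axis of an open cluster, `|u - v| = 1` (the pairs `⟨i, j⟩`
of LeBlanc et al. (2015) eq. (1) inside a cluster with open boundary conditions; no periodic bond).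
[cite: LeBlancEtAl2015, eq. (1)] -/
def lineAdj (u v : ℕ) : Prop := u + 1 = v ∨ v + 1 = u

/-- Chain adjacency is decidable. [folklore] -/
instance instDecidableLineAdj (u v : ℕ) : Decidable (lineAdj u v) :=
  inferInstanceAs (Decidable (_ ∨ _))

/-- Chain adjacency is symmetric. [folklore] -/
private theorem lineAdj_symm {u v : ℕ} (h : lineAdj u v) : lineAdj v u := h.symm

/-- Chain adjacency is irreflexive. [folklore] -/
private theorem lineAdj_irrefl (u : ℕ) : ¬ lineAdj u u := by
  rintro (h | h) <;> omega

/-- The **open rectangular cluster** `[0, a) × [0, b) ⊂ ℤ²` with FREE boundary conditions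
(nearest-neighbour bonds `|Δx| + |Δy| = 1` inside the box only), on the lexicographically ordered
vertex set `Fin a ×ₗ Fin b` of the rectangular torus. [folklore] -/
def rectBoxGraph (a b : ℕ) : SimpleGraph (Fin a ×ₗ Fin b) where
  Adj p q := ((ofLex p).2 = (ofLex q).2 ∧ lineAdj (ofLex p).1 (ofLex q).1) ∨
    ((ofLex p).1 = (ofLex q).1 ∧ lineAdj (ofLex p).2 (ofLex q).2)
  symm := ⟨fun p q h => by
    rcases h with ⟨h1, h2⟩ | ⟨h1, h2⟩
    · exact Or.inl ⟨h1.symm, lineAdj_symm h2⟩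
    · exact Or.inr ⟨h1.symm, lineAdj_symm h2⟩⟩
  loopless := ⟨fun p h => by
    rcases h with ⟨-, h2⟩ | ⟨-, h2⟩
    · exact lineAdj_irrefl _ h2
    · exact lineAdj_irrefl _ h2⟩

/-- Open-box adjacency is decidable. [folklore] -/
instance instDecidableRelRectBoxGraphAdj (a b : ℕ) : DecidableRel (rectBoxGraph a b).Adj :=
  fun p q => inferInstanceAs (Decidable (((ofLex p).2 = (ofLex q).2 ∧
    lineAdj (ofLex p).1 (ofLex q).1) ∨ ((ofLex p).1 = (ofLex q).1 ∧ lineAdj (ofLex p).2 (ofLex q).2)))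

/-- The diagonal (next-nearest-neighbour) bonds `|Δx| = |Δy| = 1` of the open rectangular cluster
`[0, a) × [0, b)`. [folklore] -/
def rectBoxDiagGraph (a b : ℕ) : SimpleGraph (Fin a ×ₗ Fin b) where
  Adj p q := lineAdj (ofLex p).1 (ofLex q).1 ∧ lineAdj (ofLex p).2 (ofLex q).2
  symm := ⟨fun _ _ h => ⟨lineAdj_symm h.1, lineAdj_symm h.2⟩⟩
  loopless := ⟨fun _ h => lineAdj_irrefl _ h.1⟩

/-- Open-box diagonal adjacency is decidable. [folklore] -/
instance instDecidableRelRectBoxDiagGraphAdj (a b : ℕ) :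
    DecidableRel (rectBoxDiagGraph a b).Adj := fun p q =>
  inferInstanceAs (Decidable (lineAdj (ofLex p).1 (ofLex q).1 ∧ lineAdj (ofLex p).2 (ofLex q).2))

/-- The **`t–t'` Hubbard Hamiltonian of the open `a × b` cluster** (free boundary conditions):
`H = -t Σ_{⟨xy⟩ ⊂ box, σ} c†_{xσ}c_{yσ} - t' Σ_{⟨⟨xy⟩⟩ ⊂ box, σ} c†_{xσ}c_{yσ} + U Σ_x n_{x↑}n_{x↓}`
(ordered pairs), i.e. LeBlanc et al. (2015) eq. (1) restricted to the bonds inside the box — the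
cluster Hamiltonian of exact-diagonalisation / DMRG studies with open boundaries.
[cite: LeBlancEtAl2015, eq. (1)] -/
def hubbardOpenBoxTT' (a b : ℕ) (t t' U : ℝ) :
    Matrix (Finset (Orb (Fin a ×ₗ Fin b))) (Finset (Orb (Fin a ×ₗ Fin b))) ℂ :=
  hamiltonian (rectBoxGraph a b) t U + hamiltonian (rectBoxDiagGraph a b) t' 0

/-- At `t' = 0` the open-cluster `t–t'` Hamiltonian is the tree's Hubbard Hamiltonian of the
open-box graph. [folklore] -/
@[simp] private theorem hubbardOpenBoxTT'_zero (a b : ℕ) (t U : ℝ) :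
    hubbardOpenBoxTT' a b t 0 U = hamiltonian (rectBoxGraph a b) t U := by
  simp [hubbardOpenBoxTT', hamiltonian]

/-- The open-cluster `t–t'` Hamiltonian is Hermitian (real hopping amplitudes, real `U`: the model of
LeBlanc et al. (2015) eq. (1) on a cluster with open boundary conditions). [cite: LeBlancEtAl2015, eq. (1)] -/
theorem hubbardOpenBoxTT'_isHermitian (a b : ℕ) (t t' U : ℝ) :
    (hubbardOpenBoxTT' a b t t' U).IsHermitian :=
  ((hamiltonian_isHermitian_and_commute_holds (rectBoxGraph a b) t U).1).add
    ((hamiltonian_isHermitian_and_commute_holds (rectBoxDiagGraph a b) t' 0).1)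

/-- The open-cluster `t–t'` Hamiltonian conserves the particle number (LeBlanc et al. (2015) eq. (1),
studied at fixed density). [cite: LeBlancEtAl2015, eq. (1)] -/
theorem hubbardOpenBoxTT'_commute_totalNumber (a b : ℕ) (t t' U : ℝ) :
    Commute (hubbardOpenBoxTT' a b t t' U) totalNumber :=
  ((hamiltonian_isHermitian_and_commute_holds (rectBoxGraph a b) t U).2.1).add_left
    ((hamiltonian_isHermitian_and_commute_holds (rectBoxDiagGraph a b) t' 0).2.1)

/-! ### Inside a block of a torus with at least two blocks per direction, ring adjacency is chain
adjacency -/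

/-- For `K ≥ 2` blocks of length `M` on the ring `ℤ/KMℤ`, two sites of the SAME block are
ring-neighbours iff their positions in the block differ by one (no wrap-around bond stays inside a
block). [folklore] -/
private theorem ringAdj_block_iff {K M : ℕ} (hK : 2 ≤ K) (i : Fin K) (x x' : Fin M) :
    ringAdj (K * M) ((i : ℕ) * M + x) ((i : ℕ) * M + x') ↔ lineAdj x x' := by
  have hi : (i : ℕ) + 1 ≤ K := i.isLt
  have h1 : ((i : ℕ) + 1) * M ≤ K * M := Nat.mul_le_mul_right M hi
  have h2 : ((i : ℕ) + 1) * M = (i : ℕ) * M + M := by ring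
  have h3 : 2 * M ≤ K * M := Nat.mul_le_mul_right M hK
  have hx := x.isLt
  have hx' := x'.isLt
  unfold ringAdj lineAdj
  rcases Nat.lt_or_ge ((i : ℕ) * M + x + 1) (K * M) with hu | hu
  · rw [Nat.mod_eq_of_lt hu]
    rcases Nat.lt_or_ge ((i : ℕ) * M + x' + 1) (K * M) with hv | hv
    · rw [Nat.mod_eq_of_lt hv]; omega
    · rw [show (i : ℕ) * M + x' + 1 = K * M by omega, Nat.mod_self]; omega
  · rw [show (i : ℕ) * M + x + 1 = K * M by omega, Nat.mod_self]
    rcases Nat.lt_or_ge ((i : ℕ) * M + x' + 1) (K * M) with hv | hv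
    · rw [Nat.mod_eq_of_lt hv]; omega
    · rw [show (i : ℕ) * M + x' + 1 = K * M by omega, Nat.mod_self]; omega

/-- Positions in a block are equal iff the block-local positions are. [folklore] -/
private theorem block_pos_eq_iff {K M A : ℕ} (hA : A = K * M) (i : Fin K) (x x' : Fin M) :
    (⟨(i : ℕ) * M + x, stripIndex_lt hA i x⟩ : Fin A) = ⟨(i : ℕ) * M + x', stripIndex_lt hA i x'⟩ ↔
      x = x' := by
  rw [Fin.mk.injEq, add_right_inj, Fin.val_inj]

/-- **The nearest-neighbour bonds of the torus inside a block are those of the open box**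
(`≥ 2` blocks in each direction). [folklore] -/
private theorem comap_blockEmb_fermionRectTorusGraph {a b Kx Ky A B : ℕ} (hKx : 2 ≤ Kx) (hKy : 2 ≤ Ky)
    (hA : A = Kx * a) (hB : B = Ky * b) (i : Fin Kx) (j : Fin Ky) :
    (fermionRectTorusGraph A B).comap (blockEmb hA hB i j) = rectBoxGraph a b := by
  ext p q
  rw [SimpleGraph.comap_adj, fermionRectTorusGraph_adj_iff]
  show ((⟨(j : ℕ) * b + (ofLex p).2, _⟩ : Fin B) = ⟨(j : ℕ) * b + (ofLex q).2, _⟩ ∧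
      ringAdj A ((i : ℕ) * a + (ofLex p).1) ((i : ℕ) * a + (ofLex q).1)) ∨
    ((⟨(i : ℕ) * a + (ofLex p).1, _⟩ : Fin A) = ⟨(i : ℕ) * a + (ofLex q).1, _⟩ ∧
      ringAdj B ((j : ℕ) * b + (ofLex p).2) ((j : ℕ) * b + (ofLex q).2)) ↔ _
  rw [block_pos_eq_iff hB, block_pos_eq_iff hA]
  subst hA hB
  rw [ringAdj_block_iff hKx i, ringAdj_block_iff hKy j]
  rfl

/-- **The diagonal bonds of the torus inside a block are those of the open box** (`≥ 2` blocks in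
each direction). [folklore] -/
private theorem comap_blockEmb_fermionRectTorusDiagGraph {a b Kx Ky A B : ℕ} (hKx : 2 ≤ Kx) (hKy : 2 ≤ Ky)
    (hA : A = Kx * a) (hB : B = Ky * b) (i : Fin Kx) (j : Fin Ky) :
    (fermionRectTorusDiagGraph A B).comap (blockEmb hA hB i j) = rectBoxDiagGraph a b := by
  ext p q
  rw [SimpleGraph.comap_adj, fermionRectTorusDiagGraph_adj_iff]
  show ringAdj A ((i : ℕ) * a + (ofLex p).1) ((i : ℕ) * a + (ofLex q).1) ∧
      ringAdj B ((j : ℕ) * b + (ofLex p).2) ((j : ℕ) * b + (ofLex q).2) ↔ _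
  subst hA hB
  rw [ringAdj_block_iff hKx i, ringAdj_block_iff hKy j]
  rfl

/-- **Open-cluster product states bound the torus from above, with no boundary penalty.**
For the `t–t'` torus `ℤ/K_x aℤ × ℤ/K_y bℤ` with `K_x, K_y ≥ 2` (at least two blocks in each
direction, so that no torus bond joins a block to itself around the torus) and any block particle
numbers `N_{ij} ≤ 2ab`:
`E_torus(Σ_{ij} N_{ij}) ≤ Σ_{ij} E_open(a × b; N_{ij})`, where `E_open` are the sector ground-state
energies of the OPEN `a × b` cluster `hubbardOpenBoxTT' a b t t' U` — the graded product of the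
cluster ground states is a trial state of the torus in which every torus bond joining two clusters
has zero expectation and every bond inside a cluster is a cluster bond (cluster / "Anderson-type"
variational upper bound; Ruelle (1969) §3.3, eq. (3.11), over sub-boxes with zero tail, for the
model of LeBlanc et al. (2015) eq. (1)). [cite: Ruelle1969, §3.3] -/
theorem groundEnergy_hubbardRectTorusTT'_le_sum_openBox (a b Kx Ky : ℕ) (hKx : 2 ≤ Kx)
    (hKy : 2 ≤ Ky) (t t' U : ℝ) (Ns : Fin Kx → Fin Ky → ℕ) (hNs : ∀ i j, Ns i j ≤ 2 * (a * b)) :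
    groundEnergy (hubbardRectTorusTT' (Kx * a) (Ky * b) t t' U) (∑ i, ∑ j, Ns i j) ≤
      ∑ i, ∑ j, groundEnergy (hubbardOpenBoxTT' a b t t' U) (Ns i j) := by
  have h := groundEnergy_twoGraph_le_sum_blocks a b t U t' 0 Kx Ky (Kx * a) (Ky * b)
    rfl rfl (fermionRectTorusGraph _ _) (fermionRectTorusDiagGraph _ _) Ns hNs
  refine h.trans (le_of_eq (Finset.sum_congr rfl fun i _ => Finset.sum_congr rfl fun j _ => ?_))
  rw [hubbardOpenBoxTT', hamiltonian_congr (comap_blockEmb_fermionRectTorusGraph hKx hKy rfl rfl i j),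
    hamiltonian_congr (comap_blockEmb_fermionRectTorusDiagGraph hKx hKy rfl rfl i j)]

/-- **Uniform filling.** `E_torus(K_x a × K_y b; K_x K_y N) ≤ K_x K_y · E_open(a × b; N)` for
`K_x, K_y ≥ 2`, `N ≤ 2ab`. [cite: Ruelle1969, §3.3] -/
theorem groundEnergy_hubbardRectTorusTT'_le_mul_openBox (a b Kx Ky : ℕ) (hKx : 2 ≤ Kx)
    (hKy : 2 ≤ Ky) (t t' U : ℝ) {N : ℕ} (hN : N ≤ 2 * (a * b)) :
    groundEnergy (hubbardRectTorusTT' (Kx * a) (Ky * b) t t' U) (Kx * Ky * N) ≤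
      (Kx * Ky : ℕ) * groundEnergy (hubbardOpenBoxTT' a b t t' U) N := by
  have h := groundEnergy_hubbardRectTorusTT'_le_sum_openBox a b Kx Ky hKx hKy t t' U (fun _ _ => N)
    (fun _ _ => hN)
  simp only [Finset.sum_const, Finset.card_univ, Fintype.card_fin, smul_eq_mul, nsmul_eq_mul] at h
  push_cast at h ⊢
  calc groundEnergy (hubbardRectTorusTT' (Kx * a) (Ky * b) t t' U) (Kx * Ky * N)
      = groundEnergy (hubbardRectTorusTT' (Kx * a) (Ky * b) t t' U) (Kx * (Ky * N)) := by
        rw [mul_assoc]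
    _ ≤ Kx * (Ky * groundEnergy (hubbardOpenBoxTT' a b t t' U) N) := h
    _ = Kx * Ky * groundEnergy (hubbardOpenBoxTT' a b t t' U) N := by ring

/-! #### Open clusters tiled by open clusters -/

/-- Chain adjacency is translation invariant: `(c + u) ~ (c + v) ↔ u ~ v`. [folklore] -/
private theorem lineAdj_add_left_iff (c u v : ℕ) : lineAdj (c + u) (c + v) ↔ lineAdj u v := by
  unfold lineAdj; omega

/-- **The nearest-neighbour bonds of an open box inside a block are those of the small open box**
(any number of blocks; an open box has no wrap-around bond). [folklore] -/
private theorem comap_blockEmb_rectBoxGraph {a b Kx Ky A B : ℕ} (hA : A = Kx * a) (hB : B = Ky * b)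
    (i : Fin Kx) (j : Fin Ky) :
    (rectBoxGraph A B).comap (blockEmb hA hB i j) = rectBoxGraph a b := by
  ext p q
  rw [SimpleGraph.comap_adj]
  show (((⟨(j : ℕ) * b + (ofLex p).2, _⟩ : Fin B) = ⟨(j : ℕ) * b + (ofLex q).2, _⟩ ∧
      lineAdj ((i : ℕ) * a + (ofLex p).1) ((i : ℕ) * a + (ofLex q).1)) ∨
    ((⟨(i : ℕ) * a + (ofLex p).1, _⟩ : Fin A) = ⟨(i : ℕ) * a + (ofLex q).1, _⟩ ∧
      lineAdj ((j : ℕ) * b + (ofLex p).2) ((j : ℕ) * b + (ofLex q).2))) ↔ _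
  rw [block_pos_eq_iff hB, block_pos_eq_iff hA, lineAdj_add_left_iff, lineAdj_add_left_iff]
  rfl

/-- **The diagonal bonds of an open box inside a block are those of the small open box.**
[folklore] -/
private theorem comap_blockEmb_rectBoxDiagGraph {a b Kx Ky A B : ℕ} (hA : A = Kx * a)
    (hB : B = Ky * b) (i : Fin Kx) (j : Fin Ky) :
    (rectBoxDiagGraph A B).comap (blockEmb hA hB i j) = rectBoxDiagGraph a b := by
  ext p q
  rw [SimpleGraph.comap_adj]
  show (lineAdj ((i : ℕ) * a + (ofLex p).1) ((i : ℕ) * a + (ofLex q).1) ∧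
      lineAdj ((j : ℕ) * b + (ofLex p).2) ((j : ℕ) * b + (ofLex q).2)) ↔ _
  rw [lineAdj_add_left_iff, lineAdj_add_left_iff]
  rfl

/-- **Open clusters tiled by open clusters.** For the OPEN `K_x a × K_y b` cluster (free boundary
conditions, `t–t'` model) and any block particle numbers `N_{ij} ≤ 2ab`:
`E_open(K_x a × K_y b; Σ_{ij} N_{ij}) ≤ Σ_{ij} E_open(a × b; N_{ij})` — the graded product of the
small-cluster sector ground states is a trial state of the big cluster in which every bond joining
two blocks has zero expectation and the bonds inside a block are exactly the bonds of the small open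
cluster (cluster variational upper bound for open-boundary exact-diagonalisation / DMRG clusters;
Ruelle (1969) §3.3, eq. (3.11) with zero tail, for the model of LeBlanc et al. (2015) eq. (1) with
open boundaries). Unlike the torus version no `K ≥ 2` hypothesis is needed. [cite: Ruelle1969, §3.3] -/
theorem groundEnergy_hubbardOpenBoxTT'_le_sum_openBox (a b Kx Ky : ℕ) (t t' U : ℝ)
    (Ns : Fin Kx → Fin Ky → ℕ) (hNs : ∀ i j, Ns i j ≤ 2 * (a * b)) :
    groundEnergy (hubbardOpenBoxTT' (Kx * a) (Ky * b) t t' U) (∑ i, ∑ j, Ns i j) ≤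
      ∑ i, ∑ j, groundEnergy (hubbardOpenBoxTT' a b t t' U) (Ns i j) := by
  have h := groundEnergy_twoGraph_le_sum_blocks a b t U t' 0 Kx Ky (Kx * a) (Ky * b)
    rfl rfl (rectBoxGraph _ _) (rectBoxDiagGraph _ _) Ns hNs
  refine h.trans (le_of_eq (Finset.sum_congr rfl fun i _ => Finset.sum_congr rfl fun j _ => ?_))
  rw [hubbardOpenBoxTT', hamiltonian_congr (comap_blockEmb_rectBoxGraph rfl rfl i j),
    hamiltonian_congr (comap_blockEmb_rectBoxDiagGraph rfl rfl i j)]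

/-- **Uniform filling, open in open.** `E_open(K_x a × K_y b; K_x K_y N) ≤ K_x K_y · E_open(a × b; N)`
for `N ≤ 2ab`. [cite: Ruelle1969, §3.3] -/
theorem groundEnergy_hubbardOpenBoxTT'_le_mul_openBox (a b Kx Ky : ℕ) (t t' U : ℝ) {N : ℕ}
    (hN : N ≤ 2 * (a * b)) :
    groundEnergy (hubbardOpenBoxTT' (Kx * a) (Ky * b) t t' U) (Kx * Ky * N) ≤
      (Kx * Ky : ℕ) * groundEnergy (hubbardOpenBoxTT' a b t t' U) N := by
  have h := groundEnergy_hubbardOpenBoxTT'_le_sum_openBox a b Kx Ky t t' U (fun _ _ => N)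
    (fun _ _ => hN)
  simp only [Finset.sum_const, Finset.card_univ, Fintype.card_fin, smul_eq_mul, nsmul_eq_mul] at h
  push_cast at h ⊢
  calc groundEnergy (hubbardOpenBoxTT' (Kx * a) (Ky * b) t t' U) (Kx * Ky * N)
      = groundEnergy (hubbardOpenBoxTT' (Kx * a) (Ky * b) t t' U) (Kx * (Ky * N)) := by
        rw [mul_assoc]
    _ ≤ Kx * (Ky * groundEnergy (hubbardOpenBoxTT' a b t t' U) N) := h
    _ = Kx * Ky * groundEnergy (hubbardOpenBoxTT' a b t t' U) N := by ring

end OpenBox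

namespace ThermodynamicLimit

/-! ### The thermodynamic limit: periodic patterns of open clusters -/

section Pattern

/-- Summing a `P`-periodic function over `Fin (R P)`: `Σ_{i < RP} f(i mod P) = R · Σ_{u < P} f(u)`.
[folklore] -/
private theorem sum_comp_modNat {M : Type*} [AddCommMonoid M] (R P : ℕ) (f : Fin P → M) :
    ∑ i : Fin (R * P), f i.modNat = R • ∑ u, f u := by
  have hmod : ∀ x : Fin R × Fin P, (finProdFinEquiv x).modNat = x.2 := by
    intro x
    have h := Equiv.symm_apply_apply finProdFinEquiv x
    rw [finProdFinEquiv_symm_apply] at h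
    exact congrArg Prod.snd h
  rw [← finProdFinEquiv.sum_comp, Fintype.sum_prod_type]
  simp_rw [hmod]
  rw [Finset.sum_const, Finset.card_univ, Fintype.card_fin]

/-- `N_L(n) = 2m` exactly when `n L² = 2m`. [folklore] -/
private theorem rectN_eq_of_mul_sq_eq {n : ℝ} {L m : ℕ} (h : n * (L : ℝ) ^ 2 = 2 * m) : rectN n L = 2 * m := by
  rw [rectN, h, show (2 * (m : ℝ)) / 2 = (m : ℝ) by ring, Nat.floor_natCast]

/-- **Open-cluster product states bound the thermodynamic-limit energy density from above.**
Let `a × b` be an open cluster and `N : Fin P_x → Fin P_y → ℕ` any finite PATTERN of cluster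
fillings (`N_{ij} ≤ 2ab`), of mean density `n̄ = (Σ_{ij} N_{ij}) / (P_x a · P_y b) < 2`. Then for
`U ≥ 0` the ground-state energy density of the `t–t'` Hubbard model satisfies
`e(t, t', U, n̄) ≤ (Σ_{ij} E_open(a × b; N_{ij})) / (P_x a · P_y b)`,
`E_open` the sector ground-state energies of the open cluster `hubbardOpenBoxTT' a b t t' U`: tile the
`L × L` torus, `L = 2K · P_x a · P_y b`, by `(L/a)(L/b)` open clusters filled according to the pattern
(exactly `N_L(n̄)` particles, no rounding), apply the penalty-free product-state bound
`groundEnergy_hubbardRectTorusTT'_le_sum_openBox`, divide by `L²` and let `K → ∞` along the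
defining sequence of `energyDensityTT'` (`energyDensityTT'_le_of_frequently_le`). In particular any
unit `N`-particle trial vector `φ` of the open cluster gives `e(N/(ab)) ≤ Re⟨φ, H_open φ⟩/(ab)`
(uniform pattern, `groundEnergy_le_re_expect`), and alternating fillings `N, N+1` give the
half-integer mean densities. Cluster variational bound in the thermodynamic limit (Ruelle (1969)
§3.3, 3.3.3 eq. (3.11)–(3.12): the limit along a special sequence of cubes is controlled by sub-box
energies), for the model of LeBlanc et al. (2015) eq. (1). [cite: Ruelle1969, §3.3] -/
theorem energyDensityTT'_le_openBox_pattern (t t' : ℝ) {U : ℝ} (hU : 0 ≤ U) {a b Px Py : ℕ}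
    (ha : 1 ≤ a) (hb : 1 ≤ b) (hPx : 1 ≤ Px) (hPy : 1 ≤ Py) (Ns : Fin Px → Fin Py → ℕ)
    (hNs : ∀ i j, Ns i j ≤ 2 * (a * b))
    (hn2 : ((∑ i, ∑ j, Ns i j : ℕ) : ℝ) < 2 * (((Px * a : ℕ) : ℝ) * ((Py * b : ℕ) : ℝ))) :
    energyDensityTT' t t' U (((∑ i, ∑ j, Ns i j : ℕ) : ℝ) / (((Px * a : ℕ) : ℝ) * ((Py * b : ℕ) : ℝ))) ≤
      (∑ i, ∑ j, groundEnergy (hubbardOpenBoxTT' a b t t' U) (Ns i j)) /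
        (((Px * a : ℕ) : ℝ) * ((Py * b : ℕ) : ℝ)) := by
  set T : ℕ := ∑ i, ∑ j, Ns i j with hT
  set S : ℝ := ∑ i, ∑ j, groundEnergy (hubbardOpenBoxTT' a b t t' U) (Ns i j) with hS
  set D : ℝ := ((Px * a : ℕ) : ℝ) * ((Py * b : ℕ) : ℝ) with hD
  have hPa : 1 ≤ Px * a := Nat.one_le_iff_ne_zero.2 (Nat.mul_ne_zero (by omega) (by omega))
  have hPb : 1 ≤ Py * b := Nat.one_le_iff_ne_zero.2 (Nat.mul_ne_zero (by omega) (by omega))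
  have hDpos : 0 < D := by
    rw [hD]; exact mul_pos (by exact_mod_cast hPa) (by exact_mod_cast hPb)
  have hn0 : 0 ≤ (T : ℝ) / D := by positivity
  have hn2' : (T : ℝ) / D < 2 := by rw [div_lt_iff₀ hDpos]; exact hn2
  refine energyDensityTT'_le_of_frequently_le t t' hU hn0 hn2' (μ := 0) ?_
  refine Filter.frequently_atTop.2 fun L₀ => ?_
  -- the torus side `L = 2K · (Px a) · (Py b)` with `K = L₀ + 1`
  set K : ℕ := L₀ + 1 with hK
  set Rx : ℕ := 2 * K * (Py * b) with hRx
  set Ry : ℕ := 2 * K * (Px * a) with hRy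
  set L : ℕ := 2 * K * (Px * a) * (Py * b) with hL
  have hK1 : 1 ≤ K := by omega
  have hRx2 : 2 ≤ Rx := by
    rw [hRx]; calc 2 = 2 * 1 * 1 := by ring
      _ ≤ 2 * K * (Py * b) := Nat.mul_le_mul (Nat.mul_le_mul_left 2 hK1) hPb
  have hRy2 : 2 ≤ Ry := by
    rw [hRy]; calc 2 = 2 * 1 * 1 := by ring
      _ ≤ 2 * K * (Px * a) := Nat.mul_le_mul (Nat.mul_le_mul_left 2 hK1) hPa
  have hKx2 : 2 ≤ Rx * Px := le_trans hRx2 (Nat.le_mul_of_pos_right _ (by omega))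
  have hKy2 : 2 ≤ Ry * Py := le_trans hRy2 (Nat.le_mul_of_pos_right _ (by omega))
  have hLx : Rx * Px * a = L := by rw [hRx, hL]; ring
  have hLy : Ry * Py * b = L := by rw [hRy, hL]; ring
  refine ⟨L, ?_, ?_⟩
  · -- `L ≥ L₀`
    have : K ≤ L := by
      rw [hL]
      calc K = 1 * K * 1 * 1 := by ring
        _ ≤ 2 * K * (Px * a) * (Py * b) :=
          Nat.mul_le_mul (Nat.mul_le_mul (Nat.mul_le_mul_right K (by norm_num)) hPa) hPb
    omega
  · -- the pattern, repeated
    set Ns' : Fin (Rx * Px) → Fin (Ry * Py) → ℕ := fun i j => Ns i.modNat j.modNat with hNs'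
    have hfin := groundEnergy_hubbardRectTorusTT'_le_sum_openBox a b (Rx * Px) (Ry * Py) hKx2 hKy2
      t t' U Ns' (fun i j => hNs _ _)
    have hsumN : ∑ i, ∑ j, Ns' i j = Rx * Ry * T := by
      simp only [hNs']
      have h1 : ∀ i : Fin (Rx * Px), ∑ j : Fin (Ry * Py), Ns i.modNat j.modNat =
          Ry * ∑ v, Ns i.modNat v := fun i => by
        rw [sum_comp_modNat Ry Py (fun v => Ns i.modNat v), smul_eq_mul]
      simp_rw [h1]
      rw [sum_comp_modNat Rx Px (fun u => Ry * ∑ v, Ns u v), smul_eq_mul, ← Finset.mul_sum, hT]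
      ring
    have hsumE : ∑ i, ∑ j, groundEnergy (hubbardOpenBoxTT' a b t t' U) (Ns' i j) =
        ((Rx * Ry : ℕ) : ℝ) * S := by
      simp only [hNs']
      have h1 : ∀ i : Fin (Rx * Px), ∑ j : Fin (Ry * Py),
          groundEnergy (hubbardOpenBoxTT' a b t t' U) (Ns i.modNat j.modNat) =
          (Ry : ℝ) * ∑ v, groundEnergy (hubbardOpenBoxTT' a b t t' U) (Ns i.modNat v) := fun i => by
        rw [sum_comp_modNat Ry Py (fun v => groundEnergy (hubbardOpenBoxTT' a b t t' U) (Ns i.modNat v)),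
          nsmul_eq_mul]
      simp_rw [h1]
      rw [sum_comp_modNat Rx Px
          (fun u => (Ry : ℝ) * ∑ v, groundEnergy (hubbardOpenBoxTT' a b t t' U) (Ns u v)),
        nsmul_eq_mul, ← Finset.mul_sum, hS]
      push_cast; ring
    rw [hsumN, hsumE, hLx, hLy] at hfin
    -- the particle number along the sequence is exact
    have hLsq : ((L : ℕ) : ℝ) ^ 2 = ((Rx * Ry : ℕ) : ℝ) * D := by
      rw [hL, hRx, hRy, hD]; push_cast; ring
    have hrect : rectN ((T : ℝ) / D) L = Rx * Ry * T := by
      have h2 : Rx * Ry * T = 2 * (K * (Py * b) * Ry * T) := by rw [hRx]; ring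
      rw [h2]
      apply rectN_eq_of_mul_sq_eq
      rw [hLsq, div_mul_eq_mul_div, mul_comm (T : ℝ), ← mul_assoc]
      field_simp
      rw [hD, hRx]; push_cast; ring
    rw [hrect, zero_mul, add_zero, div_le_div_iff₀ (by rw [hLsq]; positivity) hDpos]
    calc groundEnergy (hubbardRectTorusTT' L L t t' U) (Rx * Ry * T) * D
        ≤ ((Rx * Ry : ℕ) : ℝ) * S * D := mul_le_mul_of_nonneg_right hfin hDpos.le
      _ = S * ((L : ℕ) : ℝ) ^ 2 := by rw [hLsq]; ring

/-- **Uniform pattern**: one open cluster `a × b` with `N < 2ab` particles gives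
`e(t, t', U, N/(ab)) ≤ E_open(a × b; N)/(ab)` (`U ≥ 0`). [cite: Ruelle1969, §3.3] -/
theorem energyDensityTT'_le_openBox (t t' : ℝ) {U : ℝ} (hU : 0 ≤ U) {a b : ℕ} (ha : 1 ≤ a)
    (hb : 1 ≤ b) {N : ℕ} (hN : N < 2 * (a * b)) :
    energyDensityTT' t t' U ((N : ℝ) / ((a : ℝ) * (b : ℝ))) ≤
      groundEnergy (hubbardOpenBoxTT' a b t t' U) N / ((a : ℝ) * (b : ℝ)) := by
  have h := energyDensityTT'_le_openBox_pattern t t' hU ha hb le_rfl le_rfl (Px := 1) (Py := 1)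
    (fun _ _ => N) (fun _ _ => hN.le) (by simp only [Finset.univ_unique, Finset.sum_singleton]; push_cast; simp only [one_mul]; exact_mod_cast hN)
  simpa using h

/-- **Variational form**: every unit `N`-particle vector `φ` of the open cluster certifies
`e(t, t', U, N/(ab)) ≤ Re⟨φ, H_open(a × b) φ⟩/(ab)` (`U ≥ 0`, `N < 2ab`) — the statement a
numerical certificate (an explicit cluster state with an exactly evaluated energy) discharges.
[cite: Ruelle1969, §3.3] -/
theorem energyDensityTT'_le_re_expect_openBox (t t' : ℝ) {U : ℝ} (hU : 0 ≤ U) {a b : ℕ}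
    (ha : 1 ≤ a) (hb : 1 ≤ b) {N : ℕ} (hN : N < 2 * (a * b)) {φ : Fock (Orb (Fin a ×ₗ Fin b))}
    (hφN : IsNParticle N φ) (hφ1 : star φ ⬝ᵥ φ = 1) :
    energyDensityTT' t t' U ((N : ℝ) / ((a : ℝ) * (b : ℝ))) ≤
      (star φ ⬝ᵥ (hubbardOpenBoxTT' a b t t' U *ᵥ φ)).re / ((a : ℝ) * (b : ℝ)) := by
  refine (energyDensityTT'_le_openBox t t' hU ha hb hN).trans ?_
  have hab : (0 : ℝ) < (a : ℝ) * (b : ℝ) := by positivity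
  exact div_le_div_of_nonneg_right (groundEnergy_le_re_expect _ hφN hφ1) hab.le

end Pattern

end ThermodynamicLimit

end Literature.MathematicalPhysics.QuantumLattice

end
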